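import Summits.QuantumFields.YangMills.Theorems.PoincareLipschitzDyadicMeansWeakLimit
import HarnessLib

/-!
# (Γ2-W) The weak `L²` limit from dyadic means — the cube

Brick (Γ2-W) FILE 2 of LINE 25 «CompactnessTransfer» (crux `PoincareLipschitz.BlockLipschitzL`,
stmt-QuantumFields-23533; crux of record `UnitScaleTilt.HistoryTailL`, stmt-QuantumFields-19936;
LEAD ★w1-19936 g9 2026-08-29 12:02:03Z GO).

§1 DENSITY: in `L²(Q; F)` (`Q = {|xᵢ| < 1} ⊂ ℝ³`, Lebesgue) the indicator functions of the dyadic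
cells `D_{m,j} = {x | ∀ i, -1 + 2jᵢ/2^m ≤ xᵢ < -1 + 2(jᵢ+1)/2^m}` (`j : Fin 3 → Fin (2^m)`, Γ1's
registered `(c4)` lettering) times constant vectors have dense linear span
(`dense_span_indicatorConstLp_dyadicCell`): bounded continuous functions are dense
(`MemLp.exists_boundedContinuous_eLpNorm_sub_le`), and a bounded continuous function is uniformly
approximated on the compact cube by the dyadic step function taking its value at each cell's lower
corner.
§2 ASSEMBLY (`exists_weakLimit_of_dyadicMeans`): for `v k ∈ ℒ²(Q; ℝ⁴)` with `∫_Q ‖v k‖² ≤ Λ` whose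
dyadic-cell means all converge (the `(c4)` clause of Γ1 `stub_blowDownL2Compact`), there is ONE
`G ∈ ℒ²(Q; ℝ⁴)` with `∫_Q ‖G‖² ≤ Λ`, `∫_{D_{m,j}} v k → ∫_{D_{m,j}} G` for every cell,
`∫_Q ⟪ψ, v k⟫ → ∫_Q ⟪ψ, G⟫` for every `ψ ∈ ℒ²`, and `∫_Q φ • v k → ∫_Q φ • G` (in `ℝ⁴`) for every
bounded a.e.-strongly-measurable scalar `φ` — the pairing the `HasWeakFDerivOn` identity of S2♭″
consumes — along the WHOLE sequence (no further subsequence).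

HONEST: a helper (`--supports stmt-QuantumFields-19936 --as helper`); nothing of Γ2, S2♭″,
`BlockLipschitzL`, `HistoryTailL` is proved here; rung R3 = YM₃ on T³ — not d = 4, not Clay.
-/

set_option autoImplicit false

open MeasureTheory Filter Topology Set
open scoped RealInnerProductSpace ENNReal BigOperators

namespace Summit.QuantumFields.YangMills.Theorems.PoincareLipschitzDyadicMeansWeakLimitCube

open Summit.QuantumFields.YangMills.Theorems.PoincareLipschitzSamplingCells
  (isOpen_absCube isCompact_absCubeClosed volume_real_absCube)
open Summit.QuantumFields.YangMills.Theorems.PoincareLipschitzBlowDownModulus (openCube_subset_halfOpenCube)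
open Summit.QuantumFields.YangMills.Theorems.PoincareLipschitzBlowDownL2Compactness
  (measurableSet_dyadicCube dyadicCube_subset_halfOpenCube)
open Summit.QuantumFields.YangMills.Theorems.PoincareLipschitzDyadicMeansWeakLimit

/-! ## §1 Density of dyadic step functions in `L²(Q; F)` -/

section Density

variable {F : Type*} [NormedAddCommGroup F] [InnerProductSpace ℝ F]

/-- The dyadic cells have finite `volume.restrict Q`-measure. [folklore] -/
theorem measure_dyadicCell_ne_top (m : ℕ) (j : Fin 3 → Fin (2 ^ m)) :
    (volume.restrict {x : EuclideanSpace ℝ (Fin 3) | ∀ i : Fin 3, |x i| < 1})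
      {x : EuclideanSpace ℝ (Fin 3) | ∀ i : Fin 3,
        (-1 : ℝ) + 2 * (j i : ℕ) / (2 : ℝ) ^ m ≤ x i ∧ x i < (-1 : ℝ) + 2 * ((j i : ℕ) + 1) / (2 : ℝ) ^ m} ≠ ∞ := by
  refine ((measure_mono (subset_univ _)).trans_lt ?_).ne
  rw [Measure.restrict_apply_univ]
  exact volume_openCube_lt_top

/-- A point of the cell `D_{m,j}` is within `4/2^m` of the cell's lower corner. [folklore] -/
theorem dist_lowerCorner_le (m : ℕ) (j : Fin 3 → Fin (2 ^ m)) {x : EuclideanSpace ℝ (Fin 3)}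
    (hx : ∀ i : Fin 3,
      (-1 : ℝ) + 2 * (j i : ℕ) / (2 : ℝ) ^ m ≤ x i ∧ x i < (-1 : ℝ) + 2 * ((j i : ℕ) + 1) / (2 : ℝ) ^ m) :
    dist x (WithLp.toLp 2 (fun i => (-1 : ℝ) + 2 * (j i : ℕ) / (2 : ℝ) ^ m) : EuclideanSpace ℝ (Fin 3))
      ≤ 4 / (2 : ℝ) ^ m := by
  have hpow : (0 : ℝ) < (2 : ℝ) ^ m := by positivity
  rw [EuclideanSpace.dist_eq]
  have hcoord : ∀ i : Fin 3,
      dist (x i) ((WithLp.toLp 2 (fun i => (-1 : ℝ) + 2 * (j i : ℕ) / (2 : ℝ) ^ m) :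
        EuclideanSpace ℝ (Fin 3)) i) ^ 2 ≤ (2 / (2 : ℝ) ^ m) ^ 2 := by
    intro i
    obtain ⟨h1, h2⟩ := hx i
    have hxi : (WithLp.toLp 2 (fun i => (-1 : ℝ) + 2 * (j i : ℕ) / (2 : ℝ) ^ m) :
        EuclideanSpace ℝ (Fin 3)) i = (-1 : ℝ) + 2 * (j i : ℕ) / (2 : ℝ) ^ m := by simp
    rw [hxi, Real.dist_eq]
    have hnn : 0 ≤ x i - ((-1 : ℝ) + 2 * (j i : ℕ) / (2 : ℝ) ^ m) := by linarith
    have hub : x i - ((-1 : ℝ) + 2 * (j i : ℕ) / (2 : ℝ) ^ m) ≤ 2 / (2 : ℝ) ^ m := by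
      have : 2 * (((j i : ℕ) : ℝ) + 1) / (2 : ℝ) ^ m = 2 * (j i : ℕ) / (2 : ℝ) ^ m + 2 / (2 : ℝ) ^ m := by
        ring
      linarith
    rw [abs_of_nonneg hnn]
    exact pow_le_pow_left₀ hnn hub 2
  calc Real.sqrt (∑ i : Fin 3, dist (x i) ((WithLp.toLp 2 (fun i => (-1 : ℝ) + 2 * (j i : ℕ) / (2 : ℝ) ^ m) :
          EuclideanSpace ℝ (Fin 3)) i) ^ 2)
      ≤ Real.sqrt (∑ _i : Fin 3, (2 / (2 : ℝ) ^ m) ^ 2) :=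
        Real.sqrt_le_sqrt (Finset.sum_le_sum fun i _ => hcoord i)
    _ ≤ Real.sqrt ((4 / (2 : ℝ) ^ m) ^ 2) := by
        apply Real.sqrt_le_sqrt
        simp only [Finset.sum_const, Finset.card_univ, Fintype.card_fin, nsmul_eq_mul, Nat.cast_ofNat]
        rw [div_pow, div_pow, ← mul_div_assoc]
        exact div_le_div_of_nonneg_right (by norm_num) (by positivity)
    _ = 4 / (2 : ℝ) ^ m := Real.sqrt_sq (by positivity)

/-- **Dyadic step functions are dense in `L²(Q; F)`.**  The span of the indicator functions of the
dyadic cells `D_{m,j}` times constant vectors is dense in `Lp F 2 (volume.restrict Q)`.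
[folklore: Lusin-type density of bounded continuous functions + uniform continuity on the compact
cube] -/
theorem dense_span_indicatorConstLp_dyadicCell :
    Dense (Submodule.span ℝ
      {f : Lp F 2 (volume.restrict {x : EuclideanSpace ℝ (Fin 3) | ∀ i : Fin 3, |x i| < 1}) |
        ∃ (i : (m : ℕ) × (Fin 3 → Fin (2 ^ m))) (c : F),
          f = indicatorConstLp 2 (measurableSet_dyadicCube i.1 i.2) (measure_dyadicCell_ne_top i.1 i.2) c} :
      Set (Lp F 2 (volume.restrict {x : EuclideanSpace ℝ (Fin 3) | ∀ i : Fin 3, |x i| < 1}))) := by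
  haveI : IsFiniteMeasure (volume.restrict {x : EuclideanSpace ℝ (Fin 3) | ∀ i : Fin 3, |x i| < 1}) :=
    isFiniteMeasure_restrict.2 volume_openCube_lt_top.ne
  rw [Metric.dense_iff]
  intro f ε hε
  -- Step 1: a bounded continuous approximation
  have hf : MemLp (f : EuclideanSpace ℝ (Fin 3) → F) 2
      (volume.restrict {x : EuclideanSpace ℝ (Fin 3) | ∀ i : Fin 3, |x i| < 1}) := Lp.memLp f
  have hε3 : ENNReal.ofReal (ε / 3) ≠ 0 := (ENNReal.ofReal_pos.2 (by positivity)).ne'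
  obtain ⟨g, hg_approx, hg_mem⟩ :=
    hf.exists_boundedContinuous_eLpNorm_sub_le ENNReal.ofNat_ne_top hε3
  have hdist1 : dist f (hg_mem.toLp g) ≤ ε / 3 := by
    rw [Lp.dist_def]
    have : eLpNorm (⇑f - ⇑(hg_mem.toLp g)) 2
        (volume.restrict {x : EuclideanSpace ℝ (Fin 3) | ∀ i : Fin 3, |x i| < 1}) =
        eLpNorm (⇑f - (g : EuclideanSpace ℝ (Fin 3) → F)) 2
        (volume.restrict {x : EuclideanSpace ℝ (Fin 3) | ∀ i : Fin 3, |x i| < 1}) :=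
      eLpNorm_congr_ae (by
        filter_upwards [hg_mem.coeFn_toLp] with x hx
        simp only [Pi.sub_apply, hx])
    rw [this]
    exact ENNReal.toReal_le_of_le_ofReal (by positivity) hg_approx
  -- Step 2: uniform continuity of `g` on the compact closed cube
  have hUC := (isCompact_absCubeClosed (zero_le_one : (0 : ℝ) ≤ 1)).uniformContinuousOn_of_continuous
    g.continuous.continuousOn
  rw [Metric.uniformContinuousOn_iff_le] at hUC
  obtain ⟨δ, hδ, hδUC⟩ := hUC (ε / 9) (by positivity)
  -- Step 3: a level `m` with `4/2^m ≤ δ`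
  obtain ⟨m, hm⟩ : ∃ m : ℕ, 4 / (2 : ℝ) ^ m ≤ δ := by
    obtain ⟨n, hn⟩ := exists_nat_gt (4 / δ)
    refine ⟨n, ?_⟩
    have h2n : (n : ℝ) < (2 : ℝ) ^ n := by exact_mod_cast Nat.lt_two_pow_self
    have hpos : (0 : ℝ) < (2 : ℝ) ^ n := by positivity
    rw [div_le_iff₀ hpos]
    have h4 : 4 < (2 : ℝ) ^ n * δ := by
      have := (div_lt_iff₀ hδ).1 (hn.trans h2n)
      linarith
    linarith
  have hpow : (0 : ℝ) < (2 : ℝ) ^ m := by positivity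
  -- Step 4: the dyadic step function at level `m`, as a function `σ` and as an `L²` element `S`
  set σ : EuclideanSpace ℝ (Fin 3) → F := fun x => ∑ j : Fin 3 → Fin (2 ^ m),
    {x : EuclideanSpace ℝ (Fin 3) | ∀ i : Fin 3,
      (-1 : ℝ) + 2 * (j i : ℕ) / (2 : ℝ) ^ m ≤ x i ∧ x i < (-1 : ℝ) + 2 * ((j i : ℕ) + 1) / (2 : ℝ) ^ m}.indicator
      (fun _ => g (WithLp.toLp 2 (fun i => (-1 : ℝ) + 2 * (j i : ℕ) / (2 : ℝ) ^ m))) x with hσ_def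
  set S : Lp F 2 (volume.restrict {x : EuclideanSpace ℝ (Fin 3) | ∀ i : Fin 3, |x i| < 1}) :=
    ∑ j : Fin 3 → Fin (2 ^ m), indicatorConstLp 2 (measurableSet_dyadicCube m j)
      (measure_dyadicCell_ne_top m j) (g (WithLp.toLp 2 (fun i => (-1 : ℝ) + 2 * (j i : ℕ) / (2 : ℝ) ^ m)))
    with hS_def
  have hS_mem : S ∈ Submodule.span ℝ
      {f : Lp F 2 (volume.restrict {x : EuclideanSpace ℝ (Fin 3) | ∀ i : Fin 3, |x i| < 1}) |
        ∃ (i : (m : ℕ) × (Fin 3 → Fin (2 ^ m))) (c : F),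
          f = indicatorConstLp 2 (measurableSet_dyadicCube i.1 i.2) (measure_dyadicCell_ne_top i.1 i.2) c} := by
    rw [hS_def]
    exact Submodule.sum_mem _ fun j _ => Submodule.subset_span ⟨⟨m, j⟩, _, rfl⟩
  have hS_ae : ∀ᵐ x ∂(volume.restrict {x : EuclideanSpace ℝ (Fin 3) | ∀ i : Fin 3, |x i| < 1}), S x = σ x := by
    have h1 := Lp.coeFn_fun_finsetSum (Finset.univ : Finset (Fin 3 → Fin (2 ^ m)))
      (fun j => indicatorConstLp 2 (measurableSet_dyadicCube m j) (measure_dyadicCell_ne_top m j)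
        (μ := volume.restrict {x : EuclideanSpace ℝ (Fin 3) | ∀ i : Fin 3, |x i| < 1})
        (g (WithLp.toLp 2 (fun i => (-1 : ℝ) + 2 * (j i : ℕ) / (2 : ℝ) ^ m))))
    have h2 : ∀ᵐ x ∂(volume.restrict {x : EuclideanSpace ℝ (Fin 3) | ∀ i : Fin 3, |x i| < 1}),
        ∀ j : Fin 3 → Fin (2 ^ m),
          (indicatorConstLp 2 (measurableSet_dyadicCube m j) (measure_dyadicCell_ne_top m j)
            (μ := volume.restrict {x : EuclideanSpace ℝ (Fin 3) | ∀ i : Fin 3, |x i| < 1})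
            (g (WithLp.toLp 2 (fun i => (-1 : ℝ) + 2 * (j i : ℕ) / (2 : ℝ) ^ m))) :
              EuclideanSpace ℝ (Fin 3) → F) x =
          {x : EuclideanSpace ℝ (Fin 3) | ∀ i : Fin 3,
            (-1 : ℝ) + 2 * (j i : ℕ) / (2 : ℝ) ^ m ≤ x i ∧ x i < (-1 : ℝ) + 2 * ((j i : ℕ) + 1) / (2 : ℝ) ^ m}.indicator
            (fun _ => g (WithLp.toLp 2 (fun i => (-1 : ℝ) + 2 * (j i : ℕ) / (2 : ℝ) ^ m))) x :=
      eventually_all.2 fun j => indicatorConstLp_coeFn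
    filter_upwards [h1, h2] with x hx1 hx2
    rw [hS_def, hx1, hσ_def]
    exact Finset.sum_congr rfl fun j _ => hx2 j
  -- Step 5: pointwise bound on `Q`
  have hptw : ∀ x ∈ {x : EuclideanSpace ℝ (Fin 3) | ∀ i : Fin 3, |x i| < 1},
      ‖(g : EuclideanSpace ℝ (Fin 3) → F) x - σ x‖ ≤ ε / 9 := by
    intro x hxQ
    have hxC := openCube_subset_halfOpenCube hxQ
    obtain ⟨j, hj⟩ := exists_mem_dyadicCell m hxC
    have hσx : σ x = g (WithLp.toLp 2 (fun i => (-1 : ℝ) + 2 * (j i : ℕ) / (2 : ℝ) ^ m)) := by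
      rw [hσ_def]
      simp only
      rw [Finset.sum_eq_single j]
      · rw [indicator_of_mem (by exact hj)]
      · intro j' _ hj'
        rw [indicator_of_notMem]
        intro hx'
        exact hj' (dyadicCell_index_unique m hx' hj)
      · intro h; exact absurd (Finset.mem_univ j) h
    rw [hσx, ← dist_eq_norm]
    have hxK : x ∈ {x : EuclideanSpace ℝ (Fin 3) | ∀ i : Fin 3, |x i| ≤ 1} := fun i => (hxQ i).le
    have hcK : (WithLp.toLp 2 (fun i => (-1 : ℝ) + 2 * (j i : ℕ) / (2 : ℝ) ^ m) : EuclideanSpace ℝ (Fin 3)) ∈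
        {x : EuclideanSpace ℝ (Fin 3) | ∀ i : Fin 3, |x i| ≤ 1} := by
      intro i
      have hj2 : ((j i : ℕ) : ℝ) + 1 ≤ (2 : ℝ) ^ m := by exact_mod_cast (j i).isLt
      have e : (WithLp.toLp 2 (fun i => (-1 : ℝ) + 2 * (j i : ℕ) / (2 : ℝ) ^ m) : EuclideanSpace ℝ (Fin 3)) i
          = (-1 : ℝ) + 2 * (j i : ℕ) / (2 : ℝ) ^ m := by simp
      rw [e, abs_le]
      constructor
      · have : (0 : ℝ) ≤ 2 * (j i : ℕ) / (2 : ℝ) ^ m := by positivity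
        linarith
      · have : 2 * ((j i : ℕ) : ℝ) / (2 : ℝ) ^ m ≤ 2 := by
          rw [div_le_iff₀ hpow]; nlinarith
        linarith
    exact hδUC x hxK _ hcK ((dist_lowerCorner_le m j hj).trans hm)
  -- Step 6: the `L²` distance from `g` to the step function
  have hdist2 : dist (hg_mem.toLp g) S < ε / 3 := by
    rw [dist_eq_norm]
    have hsq : ‖hg_mem.toLp g - S‖ ^ 2 ≤ 8 * (ε / 9) ^ 2 := by
      rw [norm_Lp_two_sq]
      have hint : Integrable (fun x => ‖(hg_mem.toLp g - S) x‖ ^ 2)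
          (volume.restrict {x : EuclideanSpace ℝ (Fin 3) | ∀ i : Fin 3, |x i| < 1}) := by
        have h2 : MemLp ((hg_mem.toLp g - S : Lp F 2 _) : EuclideanSpace ℝ (Fin 3) → F) ((2 : ℕ) : ℝ≥0∞)
            (volume.restrict {x : EuclideanSpace ℝ (Fin 3) | ∀ i : Fin 3, |x i| < 1}) := by
          simpa using Lp.memLp (hg_mem.toLp g - S)
        exact h2.integrable_norm_pow two_ne_zero
      have hle : ∫ x, ‖(hg_mem.toLp g - S) x‖ ^ 2
            ∂(volume.restrict {x : EuclideanSpace ℝ (Fin 3) | ∀ i : Fin 3, |x i| < 1}) ≤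
          ∫ _x, (ε / 9) ^ 2 ∂(volume.restrict {x : EuclideanSpace ℝ (Fin 3) | ∀ i : Fin 3, |x i| < 1}) := by
        refine integral_mono_ae hint (integrable_const _) ?_
        filter_upwards [ae_restrict_mem (isOpen_absCube 1).measurableSet,
          Lp.coeFn_sub (hg_mem.toLp g) S, hg_mem.coeFn_toLp, hS_ae] with x hxQ hsub hgx hSx
        rw [hsub, Pi.sub_apply, hgx, hSx]
        exact pow_le_pow_left₀ (norm_nonneg _) (hptw x hxQ) 2
      refine hle.trans (le_of_eq ?_)
      rw [integral_const, measureReal_restrict_apply_univ, smul_eq_mul, measureReal_def,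
        volume_real_absCube zero_le_one]
      ring
    have hlt : 8 * (ε / 9) ^ 2 < (ε / 3) ^ 2 := by nlinarith
    exact lt_of_pow_lt_pow_left₀ 2 (by positivity) (hsq.trans_lt hlt)
  -- Step 7: conclude
  refine ⟨S, ?_, hS_mem⟩
  rw [Metric.mem_ball, dist_comm]
  calc dist f S ≤ dist f (hg_mem.toLp g) + dist (hg_mem.toLp g) S := dist_triangle _ _ _
    _ < ε / 3 + ε / 3 := add_lt_add_of_le_of_lt hdist1 hdist2
    _ < ε := by linarith

end Density

/-! ## §2 Assembly in Γ1's `(c4)` lettering -/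

/-- **(Γ2-W) The weak `L²(Q; ℝ⁴)` limit from dyadic means.**  Let `v k : ℝ³ → ℝ⁴` be in
`ℒ²(Q)` (`Q = {|xᵢ| < 1}`) with `∫_Q ‖v k‖² ≤ Λ`, and suppose every dyadic-cell mean converges:
`∀ m j, ∃ g, ∫_{D_{m,j}} v k → g` (the `(c4)` clause of Γ1 `stub_blowDownL2Compact`, per direction).
Then there is ONE `G ∈ ℒ²(Q; ℝ⁴)` with `∫_Q ‖G‖² ≤ Λ` such that, along the WHOLE sequence:
`∫_{D_{m,j}} v k → ∫_{D_{m,j}} G` for every cell; `∫_Q ⟪ψ, v k⟫ → ∫_Q ⟪ψ, G⟫` for every `ψ ∈ ℒ²(Q)`;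
and `∫_Q φ • v k → ∫_Q φ • G` in `ℝ⁴` for every bounded a.e.-strongly-measurable scalar `φ` (the
pairing in the `HasWeakFDerivOn` identity). [folklore: Riesz + density of dyadic step functions] -/
theorem exists_weakLimit_of_dyadicMeans
    (v : ℕ → EuclideanSpace ℝ (Fin 3) → EuclideanSpace ℝ (Fin 4))
    (hv : ∀ k, MemLp (v k) 2 (volume.restrict {x : EuclideanSpace ℝ (Fin 3) | ∀ i : Fin 3, |x i| < 1}))
    (Λ : ℝ) (hΛ : ∀ k, ∫ x in {x : EuclideanSpace ℝ (Fin 3) | ∀ i : Fin 3, |x i| < 1}, ‖v k x‖ ^ 2 ≤ Λ)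
    (hc4 : ∀ (m : ℕ) (j : Fin 3 → Fin (2 ^ m)), ∃ g : EuclideanSpace ℝ (Fin 4),
      Tendsto (fun k : ℕ => ∫ x in {x : EuclideanSpace ℝ (Fin 3) | ∀ i : Fin 3,
        (-1 : ℝ) + 2 * (j i : ℕ) / (2 : ℝ) ^ m ≤ x i ∧ x i < (-1 : ℝ) + 2 * ((j i : ℕ) + 1) / (2 : ℝ) ^ m}, v k x)
        atTop (𝓝 g)) :
    ∃ G : EuclideanSpace ℝ (Fin 3) → EuclideanSpace ℝ (Fin 4),
      MemLp G 2 (volume.restrict {x : EuclideanSpace ℝ (Fin 3) | ∀ i : Fin 3, |x i| < 1}) ∧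
      ∫ x in {x : EuclideanSpace ℝ (Fin 3) | ∀ i : Fin 3, |x i| < 1}, ‖G x‖ ^ 2 ≤ Λ ∧
      (∀ (m : ℕ) (j : Fin 3 → Fin (2 ^ m)),
        Tendsto (fun k : ℕ => ∫ x in {x : EuclideanSpace ℝ (Fin 3) | ∀ i : Fin 3,
          (-1 : ℝ) + 2 * (j i : ℕ) / (2 : ℝ) ^ m ≤ x i ∧ x i < (-1 : ℝ) + 2 * ((j i : ℕ) + 1) / (2 : ℝ) ^ m}, v k x)
          atTop (𝓝 (∫ x in {x : EuclideanSpace ℝ (Fin 3) | ∀ i : Fin 3,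
          (-1 : ℝ) + 2 * (j i : ℕ) / (2 : ℝ) ^ m ≤ x i ∧ x i < (-1 : ℝ) + 2 * ((j i : ℕ) + 1) / (2 : ℝ) ^ m}, G x))) ∧
      (∀ ψ : EuclideanSpace ℝ (Fin 3) → EuclideanSpace ℝ (Fin 4),
        MemLp ψ 2 (volume.restrict {x : EuclideanSpace ℝ (Fin 3) | ∀ i : Fin 3, |x i| < 1}) →
        Tendsto (fun k : ℕ => ∫ x in {x : EuclideanSpace ℝ (Fin 3) | ∀ i : Fin 3, |x i| < 1}, ⟪ψ x, v k x⟫)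
          atTop (𝓝 (∫ x in {x : EuclideanSpace ℝ (Fin 3) | ∀ i : Fin 3, |x i| < 1}, ⟪ψ x, G x⟫))) ∧
      (∀ (φ : EuclideanSpace ℝ (Fin 3) → ℝ) (B : ℝ),
        AEStronglyMeasurable φ (volume.restrict {x : EuclideanSpace ℝ (Fin 3) | ∀ i : Fin 3, |x i| < 1}) →
        (∀ x, |φ x| ≤ B) →
        Tendsto (fun k : ℕ => ∫ x in {x : EuclideanSpace ℝ (Fin 3) | ∀ i : Fin 3, |x i| < 1}, φ x • v k x)
          atTop (𝓝 (∫ x in {x : EuclideanSpace ℝ (Fin 3) | ∀ i : Fin 3, |x i| < 1}, φ x • G x))) := by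
  haveI : IsFiniteMeasure (volume.restrict {x : EuclideanSpace ℝ (Fin 3) | ∀ i : Fin 3, |x i| < 1}) :=
    isFiniteMeasure_restrict.2 volume_openCube_lt_top.ne
  -- the general `L²` step on the sigma-indexed family of dyadic cells
  have hmean : ∀ i : (m : ℕ) × (Fin 3 → Fin (2 ^ m)), ∃ g : EuclideanSpace ℝ (Fin 4),
      Tendsto (fun k : ℕ => ∫ x in {x : EuclideanSpace ℝ (Fin 3) | ∀ l : Fin 3,
        (-1 : ℝ) + 2 * (i.2 l : ℕ) / (2 : ℝ) ^ i.1 ≤ x l ∧ x l < (-1 : ℝ) + 2 * ((i.2 l : ℕ) + 1) / (2 : ℝ) ^ i.1}, v k x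
        ∂(volume.restrict {x : EuclideanSpace ℝ (Fin 3) | ∀ i : Fin 3, |x i| < 1})) atTop (𝓝 g) := by
    rintro ⟨m, j⟩
    obtain ⟨g, hg⟩ := hc4 m j
    refine ⟨g, ?_⟩
    simp_rw [restrict_openCube_restrict_dyadicCell m j]
    exact hg
  obtain ⟨G, hG, hGΛ, hGmean, hGψ⟩ := exists_weakLimit_of_setIntegral_tendsto
    (μ := volume.restrict {x : EuclideanSpace ℝ (Fin 3) | ∀ i : Fin 3, |x i| < 1})
    (fun i : (m : ℕ) × (Fin 3 → Fin (2 ^ m)) => {x : EuclideanSpace ℝ (Fin 3) | ∀ l : Fin 3,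
      (-1 : ℝ) + 2 * (i.2 l : ℕ) / (2 : ℝ) ^ i.1 ≤ x l ∧ x l < (-1 : ℝ) + 2 * ((i.2 l : ℕ) + 1) / (2 : ℝ) ^ i.1})
    (fun i => measurableSet_dyadicCube i.1 i.2) (fun i => measure_dyadicCell_ne_top i.1 i.2)
    dense_span_indicatorConstLp_dyadicCell v hv Λ hΛ hmean
  refine ⟨G, hG, hGΛ, fun m j => ?_, hGψ, fun φ B hφ hφB => ?_⟩
  · have := hGmean ⟨m, j⟩
    simp_rw [restrict_openCube_restrict_dyadicCell m j] at this
    exact this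
  · -- the vector-valued pairing, coordinate by coordinate in an orthonormal basis of `ℝ⁴`
    have hφtop : MemLp φ ∞ (volume.restrict {x : EuclideanSpace ℝ (Fin 3) | ∀ i : Fin 3, |x i| < 1}) :=
      memLp_top_of_bound hφ B (Eventually.of_forall fun x => by rw [Real.norm_eq_abs]; exact hφB x)
    have hint : ∀ (w : EuclideanSpace ℝ (Fin 3) → EuclideanSpace ℝ (Fin 4)),
        MemLp w 2 (volume.restrict {x : EuclideanSpace ℝ (Fin 3) | ∀ i : Fin 3, |x i| < 1}) →
        Integrable (fun x => φ x • w x) (volume.restrict {x : EuclideanSpace ℝ (Fin 3) | ∀ i : Fin 3, |x i| < 1}) :=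
      fun w hw => (hw.integrable one_le_two).smul_of_top_right hφtop
    -- scalar pairings `⟪c, ∫ φ • w⟫ = ∫ ⟪φ • c, w⟫`
    have hscal : ∀ (c : EuclideanSpace ℝ (Fin 4)) (w : EuclideanSpace ℝ (Fin 3) → EuclideanSpace ℝ (Fin 4)),
        MemLp w 2 (volume.restrict {x : EuclideanSpace ℝ (Fin 3) | ∀ i : Fin 3, |x i| < 1}) →
        ⟪c, ∫ x in {x : EuclideanSpace ℝ (Fin 3) | ∀ i : Fin 3, |x i| < 1}, φ x • w x⟫ =
          ∫ x in {x : EuclideanSpace ℝ (Fin 3) | ∀ i : Fin 3, |x i| < 1}, ⟪φ x • c, w x⟫ := by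
      intro c w hw
      rw [← integral_inner (hint w hw) c]
      refine integral_congr_ae (Eventually.of_forall fun x => ?_)
      simp only [real_inner_smul_left, real_inner_smul_right]
    have hψc : ∀ c : EuclideanSpace ℝ (Fin 4), MemLp (fun x => φ x • c) 2
        (volume.restrict {x : EuclideanSpace ℝ (Fin 3) | ∀ i : Fin 3, |x i| < 1}) := fun c =>
      MemLp.of_bound (hφ.smul_const c) (B * ‖c‖) (Eventually.of_forall fun x => by
        rw [norm_smul, Real.norm_eq_abs]
        exact mul_le_mul_of_nonneg_right (hφB x) (norm_nonneg _))
    have hcoord : ∀ c : EuclideanSpace ℝ (Fin 4),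
        Tendsto (fun k : ℕ => ⟪c, ∫ x in {x : EuclideanSpace ℝ (Fin 3) | ∀ i : Fin 3, |x i| < 1}, φ x • v k x⟫)
          atTop (𝓝 ⟪c, ∫ x in {x : EuclideanSpace ℝ (Fin 3) | ∀ i : Fin 3, |x i| < 1}, φ x • G x⟫) := by
      intro c
      have h := hGψ (fun x => φ x • c) (hψc c)
      rw [hscal c G hG]
      simp_rw [hscal c (v _) (hv _)]
      exact h
    -- reassemble the vector from its coordinates in the standard orthonormal basis
    have key : ∀ y : EuclideanSpace ℝ (Fin 4),
        ∑ a, ⟪(EuclideanSpace.basisFun (Fin 4) ℝ) a, y⟫ • (EuclideanSpace.basisFun (Fin 4) ℝ) a = y :=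
      fun y => (EuclideanSpace.basisFun (Fin 4) ℝ).sum_repr' y
    have hsum := tendsto_finsetSum (Finset.univ : Finset (Fin 4))
      (fun a _ => (hcoord ((EuclideanSpace.basisFun (Fin 4) ℝ) a)).smul_const
        ((EuclideanSpace.basisFun (Fin 4) ℝ) a))
    simp only [key] at hsum
    exact hsum

end Summit.QuantumFields.YangMills.Theorems.PoincareLipschitzDyadicMeansWeakLimitCube
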